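import Summits.BirchSwinnertonDyer.BirchSwinnertonDyer.Theorems.GenusKolyvaginAtTwoPowDvdShaCardAtTwoRTRestrictionKernelIndexTwo
import Literature.Barriers.BirchSwinnertonDyer.DescentDefectUnboundedMatsunoLocalKernelProofs
import Literature.NumberTheory.EllipticCurves.LocalPointsIntegersSubgroup
import HarnessLib

/-!
# Route `GenusKolyvaginAtTwo`, LINE 18 / LINE 19 (L_T `PowDvdShaCardAtTwoRT` stmt-BirchSwinnertonDyer-23242,
# L⁺_T stmt-23379), critic idea-crit-5 VERDICT #179 price (1), first deliverable «LOCUS OF DESCENDED CLASSES AT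
# `p ∣ d_K`»: THE LOCAL KERNEL `W_{v,K} = ker(H¹(ℚ_v, E) → H¹(K_w, E))` VANISHES AT A QUADRATIC PLACE WHERE
# `E(K_w)` IS UNIQUELY `2`-DIVISIBLE — in particular at a ramified odd good prime with `Ẽ(𝔽_p)[2] = 0`

Seat `bsd-line-gk2-p3` g16 (cell `bsd-f1-sign2`), `--supports stmt-BirchSwinnertonDyer-23242` (helper; closes
nothing).  THEOREMS ONLY (no definition, no named fact, no `sorry`); BSD is not proved by any of this.

The critic's sharpening of LINE 18 v2 (#179): a class `d ∈ H¹(ℚ, E[2^M])` descending a Kolyvagin class over the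
Heegner field `K` is a priori only NORM-locally trivial at the ramified primes `p ∣ d_K`: its obstruction to
being Selmer at `p` lives in Matsuno's `W_{p,K} = ker(H¹(ℚ_p, E) → H¹(K_𝔭, E)) = H¹(Gal(K_𝔭/ℚ_p), E(K_𝔭))`,
of order `#Ẽ(𝔽_p)[2]` at a ramified odd good prime (Kramer 1981 Prop. 3, tree fact
`Kramer1981.prop3_ramifiedOddGoodNormIndex`, PROVED; Matsuno 2009 Lemma 4.2 for the lower bound).  This file proves
the VANISHING half in the tree's currency `Literature.Barriers.BirchSwinnertonDyer.Matsuno2009.localKernel`: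

* §1 `localRestrictionKer_eq_bot_of_finrank_eq_two` — for ANY field `F` of characteristic `0`, any Weierstrass
  curve `W/F` and any quadratic extension `L/F` such that `E(L) = W(L)` is uniquely `2`-divisible (`E(L)[2] = 0`
  and `E(L) = 2E(L)`): `ker(H¹(F, E) → H¹(L, E)) = 0`.  Proof: the kernel is inflated from the crossed
  homomorphisms `Γ_F → E(F̄)` vanishing on `Γ_L = galRange L` (`resKer_le_range_inflClass`), an open subgroup of
  index `2` (`galRange_eq_fixingSubgroup_fieldRange`: it is the fixing group of the copy `j(L) ⊆ F̄`, Mathlib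
  `IntermediateField.fixingSubgroup_isOpen` / `finrank_eq_fixingSubgroup_index`) whose invariants are
  `E(j(L)) ≅ E(L)` (Galois descent `mem_range_map_val_of_forall_smul_eq`); by the index-two lemma
  `PlusDescent.inflClass_eq_zero_of_apply_eq_two_smul` every such cocycle is principal (`f(σ) ∈ E(L) = 2E(L)`).
  I.e. `H¹(C₂, M) = 0` for `M` uniquely `2`-divisible, in the tree's cocycle model.
* §2 `two_divisible_adicCompletion_of_forall_two_smul` — at a finite place `w ∤ 2` of a number field, `E(K_w)[2] = 0`
  forces `E(K_w) = 2E(K_w)` (`#(E(K_w)/2) = #E(K_w)[2]·#(𝒪_w/2) = 1`, tree `card_quotient_range_nsmul_adicCompletion`).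
* §3 `localKernel_eq_bot_of_finrank_eq_two_of_forall_two_smul` — **`W_{v,K} = 0`** for `E/ℚ`, a number field
  `K`, `w ∣ v` finite with `[K_w : ℚ_v] = 2`, `w ∤ 2` and `E(K_w)[2] = 0`.  At a ramified `p ∣ d_K` of good
  reduction (`p ∤ 2N`): `E(K_𝔭)[2] ≅ Ẽ(𝔽_p)[2]`, so this is the case `a_p(E)` odd — there the `d_K`-relaxed local
  condition of the (+)-descent coincides with the Selmer condition; at `a_p` even `W_{p,K} ≠ 0` and the locus is
  a property of the Kolyvagin class (open).

References: [Kramer1981] §2 Prop. 3, §3 (proof of Thm. 2); [Matsuno2009] §3 (W_{v,K}), Lemma 4.2;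
[SerreGaloisCohomology1997] I.§2.4, I.§5.8; [MilneADT2006] I Lemma 3.3.
-/

set_option autoImplicit false
-- the Theorems namespace of this sub repeats the summit name by design (D-0017 nested layout)
set_option linter.dupNamespace false

noncomputable section

open scoped Classical

namespace Summit.BirchSwinnertonDyer.BirchSwinnertonDyer.Theorems.GenusExact.PlusDescent

open WeierstrassCurve Literature.NumberTheory.EllipticCurves Literature.NumberTheory.GaloisRepresentations
  Literature.Barriers.BirchSwinnertonDyer IntermediateField

universe u

/-! ## §1 Quadratic extensions of a field of characteristic `0`: `ker(H¹(F, E) → H¹(L, E)) = 0` when `E(L)`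
is uniquely `2`-divisible -/

section General

variable {F : Type u} [Field F] (W : WeierstrassCurve F) (L : Type u) [Field L] [Algebra F L]

/-- **`galRange L = Γ_{j(L)}`**: for `L/F` algebraic, the image of `Γ_L → Γ_F` is the fixing subgroup of the
copy `j(L) ⊆ F̄` of `L` (`j = e⁻¹ ∘ (L → L̄)`, `e : F̄ ≃ L̄` the chosen identification) — the tree's
`mem_galRange_iff_forall_apply_eq` restated with Mathlib's `IntermediateField.fixingSubgroup` of the field
range of `j`. Serre, *Galois Cohomology*, II.§1.1. [folklore] -/
theorem galRange_eq_fixingSubgroup_fieldRange [Algebra.IsAlgebraic F L] :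
    galRange (K := F) L =
      (((algEquivOfEmb L (closureEmb (K := F) L)).symm : AlgebraicClosure L →ₐ[F] AlgebraicClosure F).comp
        (IsScalarTower.toAlgHom F L (AlgebraicClosure L))).fieldRange.fixingSubgroup := by
  ext g
  rw [mem_galRange_iff_forall_apply_eq]
  constructor
  · intro hg
    refine (IntermediateField.mem_fixingSubgroup_iff _ _).mpr fun y hy ↦ ?_
    obtain ⟨x, rfl⟩ := AlgHom.mem_fieldRange.mp hy
    exact hg x
  · intro hg x
    exact (IntermediateField.mem_fixingSubgroup_iff _ _).mp hg _ (AlgHom.mem_fieldRange.mpr ⟨x, rfl⟩)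

/-- **Galois descent for points over an intermediate field of `F̄/F`** (`F` of characteristic `0`): a
geometric point fixed by `Γ_{F'} = Gal(F̄/F')` has coordinates in `F'` (`(F̄)^{Γ_{F'}} = F'`, Mathlib
`InfiniteGalois.fixedField_fixingSubgroup`), i.e. lies in the image of `E(F') → E(F̄)`.
Silverman, *AEC*, VIII.§1. [folklore] -/
theorem mem_range_map_val_of_forall_smul_eq [CharZero F] (F' : IntermediateField F (AlgebraicClosure F))
    (P : geomPoints W) (hP : ∀ τ : Field.absoluteGaloisGroup F, τ ∈ F'.fixingSubgroup → τ • P = P) :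
    P ∈ (WeierstrassCurve.Affine.Point.map (W' := W) (F'.val : F' →ₐ[F] AlgebraicClosure F)).range := by
  haveI : IsGalois F (AlgebraicClosure F) := {}
  change (W.baseChange (AlgebraicClosure F)).toAffine.Point at P
  rcases P with _ | ⟨x, y, h⟩
  · exact ⟨0, rfl⟩
  · have hxy : ∀ τ : Field.absoluteGaloisGroup F, τ ∈ F'.fixingSubgroup →
        (show AlgebraicClosure F ≃ₐ[F] AlgebraicClosure F from τ) x = x ∧
          (show AlgebraicClosure F ≃ₐ[F] AlgebraicClosure F from τ) y = y := by
      intro τ hτ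
      have hτP := hP τ hτ
      change WeierstrassCurve.Affine.Point.map
        ((show AlgebraicClosure F ≃ₐ[F] AlgebraicClosure F from τ) :
          AlgebraicClosure F →ₐ[F] AlgebraicClosure F) (.some x y h) = .some x y h at hτP
      rw [WeierstrassCurve.Affine.Point.map_some] at hτP
      simpa only [WeierstrassCurve.Affine.Point.some.injEq, AlgEquiv.coe_toAlgHom] using hτP
    have hx : x ∈ F' := by
      rw [← InfiniteGalois.fixedField_fixingSubgroup F', IntermediateField.mem_fixedField_iff]
      exact fun τ hτ ↦ (hxy τ hτ).1
    have hy : y ∈ F' := by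
      rw [← InfiniteGalois.fixedField_fixingSubgroup F', IntermediateField.mem_fixedField_iff]
      exact fun τ hτ ↦ (hxy τ hτ).2
    have h₀ : (W.baseChange F').toAffine.Nonsingular ⟨x, hx⟩ ⟨y, hy⟩ :=
      (WeierstrassCurve.Affine.baseChange_nonsingular W (f := F'.val) Subtype.val_injective
        ⟨x, hx⟩ ⟨y, hy⟩).mp h
    exact ⟨.some ⟨x, hx⟩ ⟨y, hy⟩ h₀, rfl⟩

/-- Points over an intermediate field `F'` are fixed by `Γ_{F'}` (it fixes their coordinates). [folklore] -/
theorem smul_eq_of_map_val_eq (F' : IntermediateField F (AlgebraicClosure F))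
    (Q : (W.baseChange F').toAffine.Point) (P : geomPoints W)
    (hPQ : WeierstrassCurve.Affine.Point.map (W' := W) (F'.val : F' →ₐ[F] AlgebraicClosure F) Q = P)
    {τ : Field.absoluteGaloisGroup F} (hτ : τ ∈ F'.fixingSubgroup) : τ • P = P := by
  subst hPQ
  change WeierstrassCurve.Affine.Point.map
    ((show AlgebraicClosure F ≃ₐ[F] AlgebraicClosure F from τ) : AlgebraicClosure F →ₐ[F] AlgebraicClosure F)
      (WeierstrassCurve.Affine.Point.map (W' := W) (F'.val : F' →ₐ[F] AlgebraicClosure F) Q) =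
      WeierstrassCurve.Affine.Point.map (W' := W) (F'.val : F' →ₐ[F] AlgebraicClosure F) Q
  have hc : ((show AlgebraicClosure F ≃ₐ[F] AlgebraicClosure F from τ) :
      AlgebraicClosure F →ₐ[F] AlgebraicClosure F).comp (F'.val : F' →ₐ[F] AlgebraicClosure F) = F'.val := by
    ext z
    exact (IntermediateField.mem_fixingSubgroup_iff _ _).mp hτ z.1 z.2
  rw [WeierstrassCurve.Affine.Point.map_map, hc]

/-- **`ker(H¹(F, E) → H¹(L, E)) = 0` for a quadratic extension `L/F` with `E(L)` uniquely `2`-divisible**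
(`F` of characteristic `0`, `W/F` any Weierstrass curve): if `[L : F] = 2`, `E(L)[2] = 0` and `E(L) = 2E(L)`
then no non-zero class of `H¹(F, E)` dies in `H¹(L, E)` — `H¹(Gal(L/F), E(L)) = 0`.  The kernel is inflated
from crossed homomorphisms vanishing on `Γ_L = galRange L` (`resKer_le_range_inflClass`), open of index `2`
with invariants `E(L)`; such a cocycle `f` has `f(σ) ∈ E(L) = 2E(L)`, hence is principal
(`inflClass_eq_zero_of_apply_eq_two_smul`). Serre, *Galois Cohomology*, I.§2.4 and I.§5.8; Kramer 1981 §3.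
[cite: SerreGaloisCohomology1997, I.§2.4 and I.§5.8] [cite: Kramer1981, §3 (proof of Thm. 2)] -/
theorem localRestrictionKer_eq_bot_of_finrank_eq_two [CharZero F] [FiniteDimensional F L]
    (h2 : Module.finrank F L = 2)
    (htors : ∀ P : (W.baseChange L).toAffine.Point, 2 • P = 0 → P = 0)
    (hdiv : ∀ P : (W.baseChange L).toAffine.Point, ∃ Q : (W.baseChange L).toAffine.Point, 2 • Q = P) :
    W.localRestrictionKer L = ⊥ := by
  haveI : Algebra.IsAlgebraic F L := Algebra.IsAlgebraic.of_finite F L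
  haveI : IsGalois F (AlgebraicClosure F) := {}
  -- the copy `j : L → F̄` and its field range `F'`
  set e : AlgebraicClosure F ≃ₐ[F] AlgebraicClosure L := algEquivOfEmb L (closureEmb (K := F) L) with he
  set j : L →ₐ[F] AlgebraicClosure F :=
    ((e.symm : AlgebraicClosure L →ₐ[F] AlgebraicClosure F).comp
      (IsScalarTower.toAlgHom F L (AlgebraicClosure L))) with hj
  set F' : IntermediateField F (AlgebraicClosure F) := j.fieldRange with hF'
  set N : Subgroup (Field.absoluteGaloisGroup F) := galRange (K := F) L with hNdef
  have hN : N = F'.fixingSubgroup := galRange_eq_fixingSubgroup_fieldRange L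
  let eL : L ≃ₐ[F] F' := AlgHom.equivFieldRange j
  haveI : FiniteDimensional F F' := LinearEquiv.finiteDimensional eL.toLinearEquiv
  have hNopen : IsOpen (N : Set (Field.absoluteGaloisGroup F)) := by
    rw [hN]; exact IntermediateField.fixingSubgroup_isOpen F'
  have hidx : N.index = 2 := by
    rw [hN]
    refine ((IntermediateField.finrank_eq_fixingSubgroup_index F').symm.trans ?_)
    rw [← eL.toLinearEquiv.finrank_eq, h2]
  haveI : N.Normal := Subgroup.normal_of_index_eq_two hidx
  obtain ⟨σ, hσ⟩ := Subgroup.index_eq_two_iff.mp hidx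
  -- the invariants: `S = E(F') ≅ E(L)`
  set m : (W.baseChange F').toAffine.Point →+ geomPoints W :=
    WeierstrassCurve.Affine.Point.map (W' := W) (F'.val : F' →ₐ[F] AlgebraicClosure F) with hm
  have hminj : Function.Injective m := WeierstrassCurve.Affine.Point.map_injective _
  set S : AddSubgroup (geomPoints W) := m.range with hSdef
  have hS : ∀ P : geomPoints W, P ∈ S ↔ ∀ n ∈ N, n • P = P := by
    intro P
    rw [hN]
    refine ⟨?_, mem_range_map_val_of_forall_smul_eq W F' P⟩
    rintro ⟨Q, rfl⟩ τ hτ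
    exact smul_eq_of_map_val_eq W F' Q _ rfl hτ
  let m₁ : (W.baseChange L).toAffine.Point →+ (W.baseChange F').toAffine.Point :=
    WeierstrassCurve.Affine.Point.map (W' := W) (eL : L →ₐ[F] F')
  have hm₁ : Function.Bijective m₁ := by
    refine ⟨WeierstrassCurve.Affine.Point.map_injective _, fun Q ↦
      ⟨WeierstrassCurve.Affine.Point.map (W' := W) (eL.symm : F' →ₐ[F] L) Q, ?_⟩⟩
    change WeierstrassCurve.Affine.Point.map _ (WeierstrassCurve.Affine.Point.map _ Q) = Q
    rw [WeierstrassCurve.Affine.Point.map_map, AlgEquiv.comp_symm]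
    cases Q <;> rfl
  let eS : (W.baseChange L).toAffine.Point ≃+ S :=
    (AddEquiv.ofBijective m₁ hm₁).trans (AddMonoidHom.ofInjective hminj)
  have h2S : ∀ s ∈ S, 2 • s = 0 → s = 0 := by
    intro s hs h0
    obtain ⟨P, hP⟩ := eS.surjective ⟨s, hs⟩
    have hP2 : eS (2 • P) = 0 := by
      rw [map_nsmul, hP]
      exact Subtype.ext h0
    have hP0 : P = 0 := htors P ((map_eq_zero_iff eS eS.injective).mp hP2)
    have := congrArg (fun x : S ↦ (x : geomPoints W)) hP
    rw [hP0, map_zero] at this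
    exact this.symm
  have hdivS : ∀ s ∈ S, ∃ t ∈ S, s = 2 • t := by
    intro s hs
    obtain ⟨P, hP⟩ := eS.surjective ⟨s, hs⟩
    obtain ⟨Q, hQ⟩ := hdiv P
    refine ⟨(eS Q : S), (eS Q).2, ?_⟩
    have := congrArg (fun x : S ↦ (x : geomPoints W)) hP
    rw [← hQ, map_nsmul] at this
    simpa only [AddSubgroupClass.coe_nsmul] using this.symm
  -- every class of the kernel is inflated from a cocycle vanishing on `N`, and such classes vanish
  rw [eq_bot_iff]
  intro c hc
  obtain ⟨f, hf⟩ := resKer_le_range_inflClass (resGal (K := F) L) (pointsMap W L) (pointsMap_smul W L)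
    (pointsMapOfEmb_bijective L W _) N hNopen (by rw [hNdef]; exact le_rfl) hc
  rw [AddSubgroup.mem_bot, ← hf]
  obtain ⟨t, ht, hft⟩ := hdivS (f.1 σ) (apply_mem_of_invariants hS f σ)
  exact inflClass_eq_zero_of_apply_eq_two_smul hNopen hσ hS h2S f ht hft

end General

/-! ## §2 `E(K_w)` is `2`-divisible at a finite place `w ∤ 2` when `E(K_w)[2] = 0` -/

section Divisible

open NumberField IsDedekindDomain

variable {K : Type} [Field K] [NumberField K] (W' : WeierstrassCurve K) [W'.IsElliptic]
  (w : HeightOneSpectrum (𝓞 K))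

/-- **`E(K_w) = 2 E(K_w)` at `w ∤ 2` when `E(K_w)[2] = 0`**: Milne's count `#(E(K_w)/2E(K_w)) =
#E(K_w)[2] · #(𝒪_w/2𝒪_w)` (tree `card_quotient_range_nsmul_adicCompletion`, *ADT* I Lemma 3.3) with `2` a unit of
`𝒪_w` and no `2`-torsion gives a quotient of order `1`. [cite: MilneADT2006, I Lemma 3.3] -/
theorem two_divisible_adicCompletion_of_forall_two_smul (hw : ((2 : ℕ) : 𝓞 K) ∉ w.asIdeal)
    (htors : ∀ P : (W'.baseChange (w.adicCompletion K)).toAffine.Point, 2 • P = 0 → P = 0)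
    (P : (W'.baseChange (w.adicCompletion K)).toAffine.Point) :
    ∃ Q : (W'.baseChange (w.adicCompletion K)).toAffine.Point, 2 • Q = P := by
  have hcount := W'.card_quotient_range_nsmul_adicCompletion w (n := 2) two_ne_zero
  -- `E(K_w)[2] = 0`
  have hker : (nsmulAddMonoidHom 2 : (W'.baseChange (w.adicCompletion K)).toAffine.Point →+ _).ker = ⊥ := by
    rw [eq_bot_iff]
    intro x hx
    rw [AddSubgroup.mem_bot]
    exact htors x ((AddMonoidHom.mem_ker).mp hx)
  -- `#(𝒪_w / 2) = 1`: `2` is a unit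
  have hunit : IsUnit ((2 : ℕ) : w.adicCompletionIntegers K) := by
    rw [LocalPoints.isUnit_iff_valuation_eq_one]
    have h := LocalPoints.valuation_natCast_eq_one w hw
    exact_mod_cast h
  have hspan : Ideal.span {((2 : ℕ) : w.adicCompletionIntegers K)} = ⊤ :=
    Ideal.span_singleton_eq_top.mpr hunit
  have hq1 : Nat.card (w.adicCompletionIntegers K ⧸ Ideal.span {((2 : ℕ) : w.adicCompletionIntegers K)}) = 1 := by
    rw [hspan]
    exact Nat.card_unique
  have hidx : (nsmulAddMonoidHom 2 : (W'.baseChange (w.adicCompletion K)).toAffine.Point →+ _).range.index = 1 := by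
    rw [AddSubgroup.index, hcount, hker, AddSubgroup.card_bot, hq1]
  have hP : P ∈ (nsmulAddMonoidHom 2 : (W'.baseChange (w.adicCompletion K)).toAffine.Point →+ _).range := by
    rw [AddSubgroup.index_eq_one.mp hidx]; exact AddSubgroup.mem_top P
  obtain ⟨Q, hQ⟩ := hP
  exact ⟨Q, hQ⟩

end Divisible

/-! ## §3 Matsuno's `W_{v,K}` vanishes at a quadratic place with `E(K_w)[2] = 0`, `w ∤ 2` -/

section Local

open NumberField IsDedekindDomain

/-- **`W_{v,K} = 0` at a quadratic place without local `2`-torsion.** For an elliptic curve `E/ℚ`, a number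
field `K`, a finite place `v` of `ℚ` and `w ∣ v` of `K` with `[K_w : ℚ_v] = 2`, `w ∤ 2` and `E(K_w)[2] = 0`:
Matsuno's local kernel `W_{v,K} = ker(H¹(ℚ_v, E) → H¹(K_w, E))` (`Matsuno2009.localKernel`) is trivial.  At a
ramified odd prime `p ∣ d_K` of good reduction this is the case `Ẽ(𝔽_p)[2] = 0` (`a_p` odd) of Kramer 1981
Prop. 3 (`i(K/F) = dim Ẽ(k)[2] = 0`): the `d_K`-relaxed local condition of a class descended from `K`
coincides there with the Selmer condition.  Proof: §1 for `F = ℚ_v`, `L = K_w` (the points groups of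
`(E_{ℚ_v})_{K_w}` and `(E_K)_{K_w}` are identified through `E_{K_w}`, `pointsCongr`), with §2.
[cite: Kramer1981, §2 Prop. 3] [cite: Matsuno2009, §3 (p. 451, W_{v,K})] [cite: MilneADT2006, I Lemma 3.3] -/
theorem localKernel_eq_bot_of_finrank_eq_two_of_forall_two_smul (E : WeierstrassCurve ℚ) [E.IsElliptic]
    (K : Type) [Field K] [NumberField K] (v : HeightOneSpectrum (𝓞 ℚ)) (w : HeightOneSpectrum (𝓞 K))
    [w.asIdeal.LiesOver v.asIdeal]
    (h2 : letI : Algebra (v.adicCompletion ℚ) (w.adicCompletion K) :=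
        (Literature.NumberTheory.EllipticCurves.adicCompletionMap (K := ℚ) K v w).toAlgebra
      Module.finrank (v.adicCompletion ℚ) (w.adicCompletion K) = 2)
    (hw : ((2 : ℕ) : 𝓞 K) ∉ w.asIdeal)
    (htors : ∀ P : ((E.baseChange K).baseChange (w.adicCompletion K)).toAffine.Point, 2 • P = 0 → P = 0) :
    Matsuno2009.localKernel E K v w = ⊥ := by
  -- pin the `ℚ`-algebra structure of `ℚ_v` to the one inside `Matsuno2009.localKernel`
  letI instQv : Algebra ℚ (v.adicCompletion ℚ) :=
    IsDedekindDomain.HeightOneSpectrum.instAlgebraAdicCompletion (𝓞 ℚ) ℚ v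
  letI : Algebra (v.adicCompletion ℚ) (w.adicCompletion K) :=
    (Literature.NumberTheory.EllipticCurves.adicCompletionMap (K := ℚ) K v w).toAlgebra
  haveI : IsScalarTower ℚ (v.adicCompletion ℚ) (w.adicCompletion K) := IsScalarTower.rat
  haveI : IsScalarTower ℚ K (w.adicCompletion K) := IsScalarTower.rat
  haveI : CharZero (v.adicCompletion ℚ) :=
    charZero_of_injective_algebraMap (algebraMap ℚ (v.adicCompletion ℚ)).injective
  haveI : FiniteDimensional (v.adicCompletion ℚ) (w.adicCompletion K) :=
    Module.finite_of_finrank_eq_succ h2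
  haveI hEK : (E.baseChange K).IsElliptic := by rw [WeierstrassCurve.baseChange]; infer_instance
  -- transport `E(K_w)[2] = 0` and `E(K_w) = 2E(K_w)` to the model `(E_{ℚ_v})_{K_w}`
  let c₁ : (E.baseChange (w.adicCompletion K)).toAffine.Point ≃+
      ((E.baseChange K).baseChange (w.adicCompletion K)).toAffine.Point :=
    pointsCongr E K (w.adicCompletion K)
  let c₂ : (E.baseChange (w.adicCompletion K)).toAffine.Point ≃+
      ((E.baseChange (v.adicCompletion ℚ)).baseChange (w.adicCompletion K)).toAffine.Point :=
    pointsCongr E (v.adicCompletion ℚ) (w.adicCompletion K)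
  let c : ((E.baseChange K).baseChange (w.adicCompletion K)).toAffine.Point ≃+
      ((E.baseChange (v.adicCompletion ℚ)).baseChange (w.adicCompletion K)).toAffine.Point :=
    c₁.symm.trans c₂
  have htors' : ∀ P : ((E.baseChange (v.adicCompletion ℚ)).baseChange (w.adicCompletion K)).toAffine.Point,
      2 • P = 0 → P = 0 := by
    intro P hP
    obtain ⟨Q, rfl⟩ := c.surjective P
    rw [← map_nsmul, map_eq_zero_iff c c.injective] at hP
    rw [htors Q hP, map_zero]
  have hdiv' : ∀ P : ((E.baseChange (v.adicCompletion ℚ)).baseChange (w.adicCompletion K)).toAffine.Point,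
      ∃ Q : ((E.baseChange (v.adicCompletion ℚ)).baseChange (w.adicCompletion K)).toAffine.Point, 2 • Q = P := by
    intro P
    obtain ⟨P₀, rfl⟩ := c.surjective P
    obtain ⟨Q₀, hQ₀⟩ := two_divisible_adicCompletion_of_forall_two_smul (E.baseChange K) w hw htors P₀
    exact ⟨c Q₀, by rw [← map_nsmul, hQ₀]⟩
  unfold Matsuno2009.localKernel
  exact localRestrictionKer_eq_bot_of_finrank_eq_two _ (w.adicCompletion K) h2 htors' hdiv'

end Local

end Summit.BirchSwinnertonDyer.BirchSwinnertonDyer.Theorems.GenusExact.PlusDescent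

end
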